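import Mathlib
import HarnessLib
import Summits.BirchSwinnertonDyer.BirchSwinnertonDyer.Theses.GenusKolyvaginAtTwo
import Summits.BirchSwinnertonDyer.BirchSwinnertonDyer.Theses.ByReductionTypeAtTwo

/-!
# Sketch — crux-ideate g3 (ideator 1/2) on `RankOneAtTwoOffBigImageOddLocal` (stmt-…-23716)

Card `sharp-kolyvagin-primes-at-two`: the SHARP / FLAT / BLUNT trichotomy of Kolyvagin primes at
`p = 2` at exact level `M` (`M(ℓ) = min(v₂(ℓ+1), v₂(a_ℓ)) = M`):

* SHARP  `v₂(a_ℓ) = M < v₂(ℓ+1)`   (so `2^{M+1} ∣ ℓ + 1`);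
* FLAT   `v₂(ℓ+1) = M < v₂(a_ℓ)`;
* BLUNT  `v₂(ℓ+1) = v₂(a_ℓ) = M`.

Elementary facts PROVED here: the Kolyvagin index of a sharp prime is exactly `M`
(`kolyvaginIndex_eq_of_sharp`); the `D_ℓ`-augmentation `ℓ(ℓ+1)/2` (McCallum 1991 (4.4), proof,
"`D_ℓ = ℓ(ℓ+1)/2` on the residue field and `p^M ∣ ℓ+1`", the named defect of item 27467) is
`≡ 0 (mod 2^M)` at a sharp prime (`two_pow_dvd_augmentation_of_sharp`) and is NOT at a flat or
blunt one (`not_two_pow_dvd_augmentation`); and the PARITY LEMMA: an element of `GL₂(ℤ)` congruent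
to Gross's `[Frob ∞]`-shape `diag(1,−1)` modulo `2^M` is never sharp and never flat
(`diag_shape_not_sharp_not_flat`) — so at `Δ > 0` every `[Frob ∞]`-Kolyvagin prime is BLUNT.
First lemma of the line (not proved): `SharpRegularEquivariantChebotarevAtTwo` (R1).
BSD is not proved here; nothing in this file claims it.
-/

noncomputable section

open Literature.NumberTheory.EllipticCurves Literature.NumberTheory.GaloisRepresentations

namespace Summit.BirchSwinnertonDyer.BirchSwinnertonDyer.Cruxes.RankOneAtTwoOffBigImageOddLocal.SharpKolyvaginPrimes

/-- `ℓ` is a SHARP Kolyvagin prime at `2` of exact level `M`: `2^M ∥ a_ℓ` and `2^{M+1} ∣ ℓ + 1`. -/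
def IsSharpAtTwo (W : WeierstrassCurve ℚ) [W.IsGloballyMinimal] (M ℓ : ℕ) : Prop :=
  2 ^ (M + 1) ∣ ℓ + 1 ∧ (2 : ℤ) ^ M ∣ W.frobeniusTrace ℓ ∧ ¬ (2 : ℤ) ^ (M + 1) ∣ W.frobeniusTrace ℓ

/-- `ℓ` is a FLAT Kolyvagin prime at `2` of exact level `M`: `2^M ∥ ℓ + 1` and `2^{M+1} ∣ a_ℓ`. -/
def IsFlatAtTwo (W : WeierstrassCurve ℚ) [W.IsGloballyMinimal] (M ℓ : ℕ) : Prop :=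
  2 ^ M ∣ ℓ + 1 ∧ ¬ 2 ^ (M + 1) ∣ ℓ + 1 ∧ (2 : ℤ) ^ (M + 1) ∣ W.frobeniusTrace ℓ

/-- `ℓ` is a BLUNT Kolyvagin prime at `2` of exact level `M`: `2^M ∥ ℓ + 1` and `2^M ∥ a_ℓ`. -/
def IsBluntAtTwo (W : WeierstrassCurve ℚ) [W.IsGloballyMinimal] (M ℓ : ℕ) : Prop :=
  2 ^ M ∣ ℓ + 1 ∧ ¬ 2 ^ (M + 1) ∣ ℓ + 1 ∧
    (2 : ℤ) ^ M ∣ W.frobeniusTrace ℓ ∧ ¬ (2 : ℤ) ^ (M + 1) ∣ W.frobeniusTrace ℓ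

/-- REGULAR (transposition) residual type at `2`: `Frob_ℓ` acts on `E[2]` as a transposition, i.e.
(for `a_ℓ` even, `ℓ ∤ 2Δ`) `Δ_E` is a non-square modulo `ℓ` (the quadratic resolvent of `ℚ(E[2])`
is `ℚ(√Δ)`; `sgn ρ̄_{E,2}(Frob_ℓ) = (Δ/ℓ)`). -/
def IsRegularTypeAtTwo (W : WeierstrassCurve ℚ) (ℓ : ℕ) : Prop :=
  ¬ IsSquare (((W.Δ.num * (W.Δ.den : ℤ) : ℤ) : ZMod ℓ))

/-- A sharp prime of level `M` has Kolyvagin index (Zhang's `M(ℓ) = min(v₂(ℓ+1), v₂(a_ℓ))`)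
exactly `M`. -/
theorem kolyvaginIndex_eq_of_sharp (W : WeierstrassCurve ℚ) [W.IsGloballyMinimal] {M ℓ : ℕ}
    (h : IsSharpAtTwo W M ℓ) : Zhang2014.kolyvaginIndex W 2 ℓ = M := by
  haveI : Fact (Nat.Prime 2) := ⟨Nat.prime_two⟩
  obtain ⟨h1, h2, h3⟩ := h
  have hle : M ≤ Zhang2014.kolyvaginIndex W 2 ℓ := by
    rw [Zhang2014.le_kolyvaginIndex_iff]
    refine ⟨(pow_dvd_pow 2 (Nat.le_succ M)).trans h1, ?_⟩
    exact_mod_cast h2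
  have hlt : ¬ M + 1 ≤ Zhang2014.kolyvaginIndex W 2 ℓ := by
    rw [Zhang2014.le_kolyvaginIndex_iff]
    rintro ⟨-, h⟩
    exact h3 (by exact_mod_cast h)
  omega

/-- At a SHARP prime the `D_ℓ`-augmentation `ℓ(ℓ+1)/2` is `≡ 0 (mod 2^M)`: McCallum's step
"`p^M ∣ ℓ + 1 ⇒ P_n ∈ p^M E(K_{λ_n})`" is honest at `p = 2` exactly when `2^{M+1} ∣ ℓ + 1`. -/
theorem two_pow_dvd_augmentation_of_sharp {M ℓ : ℕ} (h : 2 ^ (M + 1) ∣ ℓ + 1) :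
    2 ^ M ∣ ℓ * (ℓ + 1) / 2 := by
  obtain ⟨k, hk⟩ := h
  have hdiv : ℓ * (ℓ + 1) / 2 = ℓ * (2 ^ M * k) := by
    rw [hk, show ℓ * (2 ^ (M + 1) * k) = ℓ * (2 ^ M * k) * 2 by ring, Nat.mul_div_cancel _ two_pos]
  rw [hdiv]
  exact ⟨ℓ * k, by ring⟩

/-- At a FLAT or BLUNT prime (`2^M ∥ ℓ + 1`, `M ≥ 1`, `ℓ` odd) the augmentation `ℓ(ℓ+1)/2` has
`2`-adic valuation exactly `M − 1 < M`: the one-bit defect named in item 27467's docstring. -/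
theorem not_two_pow_dvd_augmentation {M ℓ : ℕ} (hM : 1 ≤ M) (hℓ : Odd ℓ)
    (h : 2 ^ M ∣ ℓ + 1) (h' : ¬ 2 ^ (M + 1) ∣ ℓ + 1) : ¬ 2 ^ M ∣ ℓ * (ℓ + 1) / 2 := by
  obtain ⟨k, hk⟩ := h
  have hk_odd : ¬ 2 ∣ k := by
    rintro ⟨j, rfl⟩
    exact h' ⟨j, by rw [hk]; ring⟩
  obtain ⟨M', rfl⟩ : ∃ M', M = M' + 1 := ⟨M - 1, by omega⟩
  have hdiv : ℓ * (ℓ + 1) / 2 = ℓ * (2 ^ M' * k) := by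
    rw [hk, show ℓ * (2 ^ (M' + 1) * k) = ℓ * (2 ^ M' * k) * 2 by ring,
      Nat.mul_div_cancel _ two_pos]
  rw [hdiv]
  rintro ⟨j, hj⟩
  have h2 : 0 < (2 : ℕ) ^ M' := by positivity
  have hlk : ℓ * k = 2 * j := by
    apply Nat.eq_of_mul_eq_mul_left h2
    calc 2 ^ M' * (ℓ * k) = ℓ * (2 ^ M' * k) := by ring
      _ = 2 ^ (M' + 1) * j := hj
      _ = 2 ^ M' * (2 * j) := by ring
  have h2dvd : 2 ∣ ℓ * k := ⟨j, hlk⟩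
  rcases (Nat.Prime.dvd_mul Nat.prime_two).mp h2dvd with h2 | h2
  · exact (Nat.not_even_iff_odd.mpr hℓ) (even_iff_two_dvd.mpr h2)
  · exact hk_odd h2

/-- PARITY LEMMA (arithmetic core). Write an integral `2 × 2` matrix congruent to `diag(1, −1)`
modulo `2^M` as `g = diag(1,−1) + 2^M · (a b; c d)`. Then `tr g = 2^M (a + d)` and
`det g + 1 = 2^M ((d − a) + 2^M (ad − bc))`. SHARP would mean `a + d` odd and
`(d − a) + 2^M(ad − bc)` even; FLAT would mean `a + d` even and `(d − a) + 2^M(ad − bc)` odd; both are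
impossible for `M ≥ 1` since `a + d ≡ d − a (mod 2)`. Hence Gross's `[Frob ∞]`-class at `Δ > 0`
(`τ ∼ diag(1,−1)` on `E[2^M]`) consists of BLUNT primes only. -/
theorem diag_shape_core (M : ℕ) (hM : 1 ≤ M) (a b c d : ℤ) :
    ¬ (¬ (2 : ℤ) ∣ a + d ∧ (2 : ℤ) ∣ (d - a) + 2 ^ M * (a * d - b * c)) ∧
    ¬ ((2 : ℤ) ∣ a + d ∧ ¬ (2 : ℤ) ∣ (d - a) + 2 ^ M * (a * d - b * c)) := by
  have he : (2 : ℤ) ∣ 2 ^ M * (a * d - b * c) :=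
    Dvd.dvd.mul_right (dvd_pow_self 2 (by omega)) _
  obtain ⟨e, he⟩ := he
  rw [he]
  constructor <;> omega

/-- PARITY LEMMA (matrix form): for `g = !![1 + 2^M a, 2^M b; 2^M c, −1 + 2^M d]` (`M ≥ 1`),
`g` is neither SHARP (`2^M ∥ tr g`, `2^{M+1} ∣ det g + 1`) nor FLAT (`2^{M+1} ∣ tr g`,
`2^M ∥ det g + 1`). With `det g = ℓ`, `tr g = a_ℓ` this is «`[Frob ∞]`-primes at `Δ > 0` are BLUNT». -/
theorem diag_shape_not_sharp_not_flat (M : ℕ) (hM : 1 ≤ M) (a b c d : ℤ) :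
    let g : Matrix (Fin 2) (Fin 2) ℤ := !![1 + 2 ^ M * a, 2 ^ M * b; 2 ^ M * c, -1 + 2 ^ M * d]
    ¬ ((2 : ℤ) ^ M ∣ g.trace ∧ ¬ (2 : ℤ) ^ (M + 1) ∣ g.trace ∧ (2 : ℤ) ^ (M + 1) ∣ g.det + 1) ∧
    ¬ ((2 : ℤ) ^ (M + 1) ∣ g.trace ∧ (2 : ℤ) ^ M ∣ g.det + 1 ∧ ¬ (2 : ℤ) ^ (M + 1) ∣ g.det + 1) := by
  intro g
  have htr : g.trace = 2 ^ M * (a + d) := by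
    simp [g, Matrix.trace_fin_two_of]; ring
  have hdet : g.det + 1 = 2 ^ M * ((d - a) + 2 ^ M * (a * d - b * c)) := by
    simp [g, Matrix.det_fin_two_of]; ring
  have h2M : (2 : ℤ) ^ M ≠ 0 := pow_ne_zero _ two_ne_zero
  have key : ∀ x : ℤ, (2 : ℤ) ^ (M + 1) ∣ 2 ^ M * x ↔ (2 : ℤ) ∣ x := fun x ↦ by
    rw [pow_succ]; exact mul_dvd_mul_iff_left h2M
  rw [htr, hdet, key, key]
  obtain ⟨h1, h2⟩ := diag_shape_core M hM a b c d
  constructor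
  · rintro ⟨-, hs1, hs2⟩; exact h1 ⟨hs1, hs2⟩
  · rintro ⟨hf1, -, hf2⟩; exact h2 ⟨hf1, hf2⟩

/-- Sanity (kit job j307661, curve 37a1, `K = ℚ(√−7)`, `[ℓ, a_ℓ]`): `[31, −4]` is SHARP of level
`2` (`2⁵ ∣ 32`, `2² ∥ a`), `[61, −8]` is FLAT of level `1` (`2 ∥ 62`, `8 ∣ a`), `[5, −2]`, `[13, −2]`
are BLUNT of level `1`; the augmentation `ℓ(ℓ+1)/2` is `≡ 0 (mod 2^M)` exactly in the sharp case. -/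
example : 2 ^ (2 + 1) ∣ 31 + 1 ∧ (2 : ℤ) ^ 2 ∣ (-4 : ℤ) ∧ ¬ (2 : ℤ) ^ (2 + 1) ∣ (-4 : ℤ) := by decide
example : 2 ^ 2 ∣ 31 * (31 + 1) / 2 := by decide
example : 2 ^ 1 ∣ 61 + 1 ∧ ¬ 2 ^ (1 + 1) ∣ 61 + 1 ∧ (2 : ℤ) ^ (1 + 1) ∣ (-8 : ℤ) := by decide
example : ¬ 2 ^ 1 ∣ 61 * (61 + 1) / 2 := by decide
example : ¬ 2 ^ 1 ∣ 5 * (5 + 1) / 2 := by decide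
example : ¬ 2 ^ 1 ∣ 13 * (13 + 1) / 2 := by decide
example : ¬ 2 ^ 3 ∣ 7 * (7 + 1) / 2 := by decide
example : 2 ^ 3 ∣ 15 * (15 + 1) / 2 := by decide

/-- **R1 `SharpRegularEquivariantChebotarevAtTwo` — FIRST LEMMA of the line (not proved here).**
Q5R `EquivariantChebotarevAtTwoR` (stmt-…-27280, PROVED) with Gross's class `[Frob ∞]` replaced by
the SHARP REGULAR class of level `M`: no sign condition on `Δ`, no `FrobEqFrobInfty`; instead the
primes produced have Kolyvagin index EXACTLY `M`, `2^{M+1} ∣ ℓ + 1` (sharp) and transposition type on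
`E[2]` (regular). Image input: `ρ_{E,2^∞}` onto (the sharp regular class lives in
`Gal(ℚ(E[2^{M+1}])/ℚ) = GL₂(ℤ/2^{M+1})`, where it has density `2^{-(2M+1)}`: `1/8, 1/32, 1/128` for
`M = 1, 2, 3`, kit j307661 / `stype_groups3.out`); `K = ℚ(√d_K)` with `d_K` odd and
`d_K ∉ {±Δ, ±2Δ}·ℚ^{×2}` is then linearly disjoint from `ℚ(E[2^∞])` (whose quadratic subfields are
`ℚ(√m)`, `m ∈ ⟨−1, 2, Δ⟩`), so inertness is a free Čebotarev condition. The classes are asked to be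
detected on `Γ_{K(E[2^{M+1}])}` (one level deeper than Q5R's `hres`) — the Kummer/division-field
entanglement at level `2^{M+1}` is this lemma's "why it might fail".
[cite: McCallumLMS1991, §3 Cor. 3.2] [cite: GrossLMS1991, §3 (3.3), §9] [cite: WZhang2014, Notations (xii)] -/
def SharpRegularEquivariantChebotarevAtTwo : Prop :=
  ∀ (N : ℕ) [NeZero N] (W : WeierstrassCurve ℚ) [W.IsElliptic] [W.IsGloballyMinimal], ¬ W.HasCM →
    ∀ (K : Type) [Field K] [NumberField K], IsImaginaryQuadratic K →
    ¬ (2 : ℤ) ∣ NumberField.discr K →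
    ¬ IsSquare ((NumberField.discr K : ℚ) * W.Δ) → ¬ IsSquare (-((NumberField.discr K : ℚ) * W.Δ)) →
    ¬ IsSquare (2 * ((NumberField.discr K : ℚ) * W.Δ)) →
    ¬ IsSquare (-(2 * ((NumberField.discr K : ℚ) * W.Δ))) →
    (∀ n : ℕ, W.HasSurjectiveModNGaloisRep (2 ^ n : ℕ)) → ∀ (c : K ≃ₐ[ℚ] K), c ≠ 1 →
    ∀ (M : ℕ), 1 ≤ M → ∀ (r : ℕ)
      (cs : Fin r → WeierstrassCurve.galH1Torsion (W.baseChange K) ((2 ^ M : ℕ) : ℤ))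
      (π : Fin r → Fin r), (∀ i, cs i ≠ 0) →
      (∀ i, conjAct W c ((2 ^ M : ℕ) : ℤ) (cs i) = cs (π i)) →
      (∀ a : Fin r → ℤ, ∑ i, a i • cs i = 0 → ∀ i, (addOrderOf (cs i) : ℤ) ∣ a i) →
      (∀ a : Fin r → ℤ, (∀ ρ ∈ torsionFixing (W.baseChange K) ((2 ^ (M + 1) : ℕ) : ℤ),
        h1Eval (W.baseChange K) ((2 ^ M : ℕ) : ℤ) (∑ i, a i • cs i) ρ = 0) → ∑ i, a i • cs i = 0) →
      ∀ (Mi : Fin r → ℕ), (∀ i, addOrderOf (cs i) = 2 ^ Mi i) → ∀ (Nv : Fin r → ℕ),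
      (∀ i, Nv i ≤ Mi i) → (∀ i, Nv (π i) = Nv i) →
      Set.Infinite {ℓ : ℕ | Zhang2014.IsKolyvaginPrime N W K 2 ℓ ∧ IsSharpAtTwo W M ℓ ∧
        IsRegularTypeAtTwo W ℓ ∧
        ∀ i, ∀ v : IsDedekindDomain.HeightOneSpectrum (NumberField.RingOfIntegers K),
          (ℓ : NumberField.RingOfIntegers K) ∈ v.asIdeal → ∀ j : ℕ,
            ((2 ^ j : ℕ) : ℤ) • cs i ∈
              (W.baseChange K).torsionLocalKer (v.adicCompletion K) ((2 ^ M : ℕ) : ℤ) ↔ Nv i ≤ j}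

/-- The primes R1 produces have Kolyvagin index exactly `M` (so the classes `c_M(n)` built on them
sit at Zhang's level `M(n) = M` on the nose). -/
theorem levelExact_of_R1_prime (N : ℕ) (W : WeierstrassCurve ℚ) [W.IsGloballyMinimal]
    (K : Type) [Field K] [NumberField K] {M ℓ : ℕ}
    (h : Zhang2014.IsKolyvaginPrime N W K 2 ℓ ∧ IsSharpAtTwo W M ℓ) :
    Zhang2014.kolyvaginIndex W 2 ℓ = M :=
  kolyvaginIndex_eq_of_sharp W h.2

end Summit.BirchSwinnertonDyer.BirchSwinnertonDyer.Cruxes.RankOneAtTwoOffBigImageOddLocal.SharpKolyvaginPrimes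

end
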